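import Literature.NumberTheory.Automorphic.UnitaryGroupArchimedeanPlaces
import HarnessLib

/-!
# The `det`-power characters `η_k(g) = ∏_v det(g_{w(v)})^{k_v}` of the archimedean unitary group `U(J)(E ⊗ ℝ)`, as TERMS

Topic `NumberTheory/Automorphic`; namespace `Literature.NumberTheory.Automorphic.UnitaryGroup`.  KERNEL ONLY: two definitions with
bodies (`archDetZPowAt`, `archDetZPow`) and their formula ∕ continuity theorems; 0 records, 0 named facts, 0 `sorry`.

The tree's `UnitaryDualPair.ArchSplitting.exists_archDetZPow` (`GelbartRogawski1991/CMSplittingCharArchComponents.lean` §3) proves the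
EXISTENCE of the continuous homomorphism `η_k : U(J)(E ⊗ ℝ) → ℂˣ`, `g ↦ ∏_v det(g_{wOf v})^{k_v}` (`g_w = archAt w g ∈ U(σ_w J)(ℂ)`;
[Paul1998, §1.2 (1.2.2)]: the integer `det`-power characters of the real unitary groups; [BorelJacquet1979, §4.1]:
`G(F ⊗ ℝ) = ∏_{v∣∞} G(F_v)`).  This leaf NAMES the witness — `archDetZPow F E c N J hc wOf hw k` — with the same formula
(`coe_archDetZPow`) and continuity (`continuous_coe_archDetZPow`), so that downstream constructions (the archimedean half of the
doubled Weil representation attached to a character, `GelbartRogawski1991/DoubledWeilRepresentationArchHalfExplicit`) can be written as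
TERMS rather than `∃`-witnesses.  Nothing else is asserted.

References: A. Paul, J. Funct. Anal. 159 (1998), §1.2 (1.2.1)–(1.2.2) p. 389 [Paul1998]; A. Borel, H. Jacquet, PSPM 33.1 (1979), §4.1
[BorelJacquet1979].  Provenance: pub-hodgecm2 cell, seat item6-p3 (gen 11), X3-Char (E) analytic residual, step (A).
-/

set_option autoImplicit false

noncomputable section

open scoped Classical
open scoped Matrix
open NumberField NumberField.InfinitePlace

namespace Literature.NumberTheory.Automorphic.UnitaryGroup

section DetPow

variable (F E : Type) [Field F] [NumberField F] [Field E] [NumberField E] [Algebra F E]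
  (c : E ≃ₐ[F] E) (N : ℕ) (J : Matrix (Fin N) (Fin N) E) (hc : c ≠ 1)
  (wOf : {v : InfinitePlace F // v.IsReal} → {w : InfinitePlace E // w.IsComplex})
  (hw : ∀ v, c • (wOf v).1 = (wOf v).1)

/-- the `det`-power character at ONE real place `v`: `g ↦ det(g_{wOf v})^{k}`. [cite: Paul1998, §1.2 (1.2.2) p. 389 L25–29] -/
def archDetZPowAt (v : {v : InfinitePlace F // v.IsReal}) (k : ℤ) : arch F E c N J →* ℂˣ :=
  (zpowGroupHom k).comp
    (Matrix.GeneralLinearGroup.det.comp ((archLocal E N J (wOf v)).subtype.comp (archAt F E c N J (wOf v) (hw v) hc)))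

omit [NumberField F] [NumberField E] in
/-- formula. [cite: Paul1998, §1.2 (1.2.2) p. 389 L25–29] -/
theorem coe_archDetZPowAt (v : {v : InfinitePlace F // v.IsReal}) (k : ℤ) (g : arch F E c N J) :
    ((archDetZPowAt F E c N J hc wOf hw v k g : ℂˣ) : ℂ) =
      (((archAt F E c N J (wOf v) (hw v) hc g : archLocal E N J (wOf v)) : GL (Fin N) ℂ) : Matrix (Fin N) (Fin N) ℂ).det ^ k := by
  simp only [archDetZPowAt, MonoidHom.coe_comp, Function.comp_apply, zpowGroupHom_apply, Subgroup.coe_subtype,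
    Units.val_zpow_eq_zpow_val, Matrix.GeneralLinearGroup.val_det_apply]

/-- **the `det`-power character `η_k(g) = ∏_v det(g_{wOf v})^{k_v}` of `U(J)(E ⊗ ℝ)`** as a TERM (the witness of the tree's
`ArchSplitting.exists_archDetZPow`). [cite: Paul1998, §1.2 (1.2.2) p. 389 L25–29] [cite: BorelJacquet1979, §4.1] -/
def archDetZPow (k : {v : InfinitePlace F // v.IsReal} → ℤ) : arch F E c N J →* ℂˣ :=
  ∏ v, archDetZPowAt F E c N J hc wOf hw v (k v)

omit [NumberField E] in
/-- formula. [cite: Paul1998, §1.2 (1.2.2) p. 389 L25–29] -/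
theorem coe_archDetZPow (k : {v : InfinitePlace F // v.IsReal} → ℤ) (g : arch F E c N J) :
    ((archDetZPow F E c N J hc wOf hw k g : ℂˣ) : ℂ) =
      ∏ v : {v : InfinitePlace F // v.IsReal},
        (((archAt F E c N J (wOf v) (hw v) hc g : archLocal E N J (wOf v)) : GL (Fin N) ℂ) : Matrix (Fin N) (Fin N) ℂ).det ^ k v := by
  rw [archDetZPow, MonoidHom.finsetProd_apply, Units.coe_prod]
  exact Finset.prod_congr rfl fun v _ => coe_archDetZPowAt F E c N J hc wOf hw v (k v) g

omit [NumberField E] in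
/-- continuity. [cite: BorelJacquet1979, §4.1] -/
theorem continuous_coe_archDetZPow (k : {v : InfinitePlace F // v.IsReal} → ℤ) :
    Continuous fun g => ((archDetZPow F E c N J hc wOf hw k g : ℂˣ) : ℂ) := by
  have hcont : Continuous fun g : arch F E c N J =>
      ∏ v : {v : InfinitePlace F // v.IsReal},
        (((archAt F E c N J (wOf v) (hw v) hc g : archLocal E N J (wOf v)) : GL (Fin N) ℂ) : Matrix (Fin N) (Fin N) ℂ).det ^ k v := by
    refine continuous_finsetProd _ fun v _ => ?_
    have h1 : Continuous fun g : arch F E c N J =>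
        (((archAt F E c N J (wOf v) (hw v) hc g : archLocal E N J (wOf v)) : GL (Fin N) ℂ) : Matrix (Fin N) (Fin N) ℂ) :=
      Units.continuous_val.comp (continuous_subtype_val.comp (continuous_archAt F E c N J (wOf v) (hw v) hc))
    refine (h1.matrix_det).zpow₀ (k v) fun g => Or.inl ?_
    exact (Matrix.GeneralLinearGroup.det
      ((archAt F E c N J (wOf v) (hw v) hc g : archLocal E N J (wOf v)) : GL (Fin N) ℂ)).ne_zero
  exact hcont.congr fun g => (coe_archDetZPow F E c N J hc wOf hw k g).symm

end DetPow

end Literature.NumberTheory.Automorphic.UnitaryGroup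

end
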